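import Summits.QuantumFields.YangMills.Theorems.BalabanUVNodesN19SingleModeLogFree
import Summits.QuantumFields.YangMills.Theorems.BalabanUVNodesN19CosModeLowerBound
import Summits.QuantumFields.YangMills.Theorems.BalabanUVNodesN19OscillatingLinksMomentDiscrepancy
import Summits.QuantumFields.YangMills.Theorems.BalabanUVNodesN19KinkLowerBoundLawsCube

/-!
# YM-DAG node N19 (= NE7 proper) — THE SINGLE-MODE LAW IS `Θ(ωd∕t)`: the two-sided rows of the degree model and of its law-level
# (equal-moments ∕ `W₁`) face, each in ONE declaration

Cell `pub-ymgap`, HUMAN RULING D-0062 (Track A) ∕ D-0149 (work-bound push), R141 (C) wider-strategy seat `pub-ymgap-dag-n19-e` (strategy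
s3 = ALTERNATIVE CURRENCY), generation g32, module 3 (lineage module 141).  Route `Summits/QuantumFields/YangMills/Theses/BalabanUVNodes.lean`,
cluster item K3⁸ «SpineGivenEndpointR13SepCoPHV» (stmt-QuantumFields-27366); filed `--supports` that item `--as helper` (it proves no registered
stub).  COUNT-NEUTRAL: [bookkeeping] over the lineage's modules BY NAME — 140 `…N19SingleModeLogFree` (`exists_pair_near_cexp_l1Norm_logFree`,
`exists_mvPolynomial_near_{cos,sin}_l1Norm_logFree`: the LOG-FREE upper side), 134∕135 `…N19SingleModeLowerBound` ∕ `…N19CosModeLowerBound`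
(`exists_le_abs_sin_l1Norm_sub_eval`, `exists_le_norm_pair_sub_cexp_l1Norm`: the diagonal lower side), 125 `…N19OscillatingLinksMomentDiscrepancy`
(`abs_integral_sub_integral_le_of_near`, `continuous_l1Norm`: the transfer to laws agreeing on `Π_t`) and 137 `…N19KinkLowerBoundLawsCube`
(`exists_laws_equalMixedMoments_sin_l1Norm`: the explicit law pair); no scheme object, no Theses import; NOT a discharge claim.

CONTENT.  §1 ★★★ `singleMode_twoSided` — THE DEGREE-MODEL ROW: for all `t ≥ 512`, `ω ≥ 0`, finite `ι` (`d = |ι|`) with `ωd·(log₂t)² ≤ t∕2048`: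
(upper) SOME pair of real `MvPolynomial`s of total degree `≤ t` is within `80·ωd∕t` of `e^{iωΣ_i|x_i|}` on the whole cube, and (lower) EVERY pair
whose imaginary part has total degree `≤ t` is at distance `≥ ωd∕(20πt)` from it somewhere on the cube (the regime implies `ωd ≤ t∕10`) ·
★★ `sinMode_twoSided` (the same for `sin(ωΣ_i|x_i|)` and one real polynomial).  §2 ★★ `abs_integral_sin_l1Norm_sub_le_logFree` ∕
`abs_integral_cos_l1Norm_sub_le_logFree` — THE LAW-LEVEL (`W₁`-form) FACE, LOG-FREE: probability laws on `[−1,1]^ι` with EQUAL mixed moments of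
total degree `≤ t` integrate `sin(ωΣ|x_i|)` ∕ `cos(ωΣ|x_i|)` to within `160·ωd∕t` (module 125's `600log₂t(log₂t + 4ωd)∕t` without the logarithms,
in the regime `ωd·log₂²t ≤ t∕2048`) · ★★★ `laws_sinMode_twoSided` — THE LAW-LEVEL ROW in one declaration: `≤ 160ωd∕t` for every such pair of laws,
and module 137's explicit pair with `∫sin(ωΣ|x_i|)d(Q − P) ≥ ωd∕(10πt)`.
READING (CURRENCY-MAP v10, honest): the rows «single mode `e^{iωS_d}` ∕ `sin(ωS_d)`» and «laws agreeing on `Π_t`, single mode» are TWO-SIDED UP TO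
ABSOLUTE CONSTANTS (`80·20π`, `160·10π`) — `Θ(ωd∕t)` with NO `log t` — for `ωd ≤ t∕(2048 log₂²t)`, `t ≥ 512`; before this generation they were
two-sided up to `log²t`.  The corner `t∕(2048 log₂²t) < ωd ≤ t∕10` and the constants stay open.

HONEST FRAMING (binding).  Elementary and [folklore]∕[bookkeeping]; NO consumer in the DAG today (an optimality map of the seat's own currency,
degree model and its `W₁` face); nothing of Bałaban's instantiated; NE7 NOT PRINTED, NOT proved; N19 NOT discharged; count-neutral.  One finite `T⁴`
programme at fixed `ε`; nothing continuum ∕ `ℝ⁴` ∕ OS ∕ mass-gap ∕ Clay.  0 `def` ∕ 0 `sorry`.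
-/

noncomputable section

open Finset Complex MeasureTheory
open scoped Real

namespace Summit.QuantumFields.YangMills.Theorems.BalabanUVNodesN19SingleModeTwoSided

open Summit.QuantumFields.YangMills.Theorems.BalabanUVNodesN19SingleModeLogFree
  (exists_pair_near_cexp_l1Norm_logFree exists_mvPolynomial_near_cos_l1Norm_logFree exists_mvPolynomial_near_sin_l1Norm_logFree nine_le_logb)
open Summit.QuantumFields.YangMills.Theorems.BalabanUVNodesN19SingleModeLowerBound (exists_le_abs_sin_l1Norm_sub_eval)
open Summit.QuantumFields.YangMills.Theorems.BalabanUVNodesN19CosModeLowerBound (exists_le_norm_pair_sub_cexp_l1Norm)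
open Summit.QuantumFields.YangMills.Theorems.BalabanUVNodesN19OscillatingLinksMomentDiscrepancy
  (abs_integral_sub_integral_le_of_near continuous_l1Norm)
open Summit.QuantumFields.YangMills.Theorems.BalabanUVNodesN19KinkLowerBoundLawsCube (exists_laws_equalMixedMoments_sin_l1Norm)

variable {ι : Type*} [Fintype ι]

/-! ## §0 The regime implies the lower bound's proviso [bookkeeping] -/

/-- In the regime `ωd·(log₂t)² ≤ t∕2048`, `t ≥ 512`: `ωd ≤ t∕10` (indeed `81·ωd ≤ t∕2048`). [bookkeeping] -/
theorem card_mul_le_of_regime {t : ℕ} (ht : 512 ≤ t) {ω : ℝ} (hω : 0 ≤ ω)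
    (hreg : ω * Fintype.card ι * Real.logb 2 t ^ 2 ≤ t / 2048) : ω * Fintype.card ι ≤ t / 10 := by
  have hL9 : 9 ≤ Real.logb 2 t := nine_le_logb ht
  have ha0 : 0 ≤ ω * Fintype.card ι := mul_nonneg hω (Nat.cast_nonneg _)
  have ht0 : (0 : ℝ) ≤ t := Nat.cast_nonneg _
  have h1 : ω * Fintype.card ι * 81 ≤ ω * Fintype.card ι * Real.logb 2 t ^ 2 :=
    mul_le_mul_of_nonneg_left (by nlinarith only [hL9]) ha0
  linarith only [h1, hreg, ht0]

/-! ## §1 ★★★ The degree-model row, two-sided [folklore] -/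

/-- ★★★ **THE SINGLE-MODE LAW IS `Θ(ωd∕t)` (degree model, both sides in one declaration).**  For all `t ≥ 512`, `ω ≥ 0` and finite `ι`
(`d = |ι|`) with `ωd·(log₂t)² ≤ t∕2048`:
(UPPER, module 140) there is a pair of real `MvPolynomial`s `(Cr, Ci)` of total degree `≤ t` with `‖Cr(x) + Ci(x)·i − e^{iωΣ_i|x_i|}‖ ≤ 80·ωd∕t` for
every `x ∈ [−1,1]^ι`; (LOWER, modules 134∕135) for EVERY pair `(Cr, Ci)` with `deg Ci ≤ t` there is `x ∈ [−1,1]^ι` with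
`‖Cr(x) + Ci(x)·i − e^{iωΣ_i|x_i|}‖ ≥ ωd∕(20πt)`.  So `ωd∕(20πt) ≤ dist_∞(e^{iωS_d}, Π_t) ≤ 80ωd∕t`: NO `log t` on either side. [folklore] -/
theorem singleMode_twoSided {t : ℕ} (ht : 512 ≤ t) {ω : ℝ} (hω : 0 ≤ ω)
    (hreg : ω * Fintype.card ι * Real.logb 2 t ^ 2 ≤ t / 2048) :
    (∃ Cr Ci : MvPolynomial ι ℝ, Cr.totalDegree ≤ t ∧ Ci.totalDegree ≤ t ∧
      ∀ x : ι → ℝ, (∀ i, x i ∈ Set.Icc (-1 : ℝ) 1) →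
        ‖((MvPolynomial.eval x Cr : ℝ) : ℂ) + ((MvPolynomial.eval x Ci : ℝ) : ℂ) * I - exp (((ω * ∑ i, |x i| : ℝ) : ℂ) * I)‖ ≤
          80 * (ω * Fintype.card ι) / t) ∧
    (∀ Cr Ci : MvPolynomial ι ℝ, Ci.totalDegree ≤ t →
      ∃ x : ι → ℝ, (∀ i, x i ∈ Set.Icc (-1 : ℝ) 1) ∧
        ω * Fintype.card ι / (20 * π * t) ≤
          ‖((MvPolynomial.eval x Cr : ℝ) : ℂ) + ((MvPolynomial.eval x Ci : ℝ) : ℂ) * I - exp (((ω * ∑ i, |x i| : ℝ) : ℂ) * I)‖) :=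
  ⟨exists_pair_near_cexp_l1Norm_logFree ht hω hreg, fun Cr Ci hCi =>
    exists_le_norm_pair_sub_cexp_l1Norm (le_trans (by norm_num) ht) hω (card_mul_le_of_regime ht hω hreg) Cr Ci hCi⟩

/-- ★★ **THE SINE FACE, TWO-SIDED.**  For all `t ≥ 512`, `ω ≥ 0`, finite `ι` with `ωd·(log₂t)² ≤ t∕2048`: some `P : MvPolynomial ι ℝ` of total degree
`≤ t` has `|sin(ωΣ_i|x_i|) − P(x)| ≤ 80·ωd∕t` on the cube, and every such `P` has `|sin(ωΣ_i|x_i|) − P(x)| ≥ ωd∕(20πt)` somewhere on the cube: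
`dist_∞(sin(ωS_d), Π_t) = Θ(ωd∕t)`. [folklore] -/
theorem sinMode_twoSided {t : ℕ} (ht : 512 ≤ t) {ω : ℝ} (hω : 0 ≤ ω)
    (hreg : ω * Fintype.card ι * Real.logb 2 t ^ 2 ≤ t / 2048) :
    (∃ P : MvPolynomial ι ℝ, P.totalDegree ≤ t ∧
      ∀ x : ι → ℝ, (∀ i, x i ∈ Set.Icc (-1 : ℝ) 1) →
        |Real.sin (ω * ∑ i, |x i|) - MvPolynomial.eval x P| ≤ 80 * (ω * Fintype.card ι) / t) ∧
    (∀ P : MvPolynomial ι ℝ, P.totalDegree ≤ t →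
      ∃ x : ι → ℝ, (∀ i, x i ∈ Set.Icc (-1 : ℝ) 1) ∧
        ω * Fintype.card ι / (20 * π * t) ≤ |Real.sin (ω * ∑ i, |x i|) - MvPolynomial.eval x P|) :=
  ⟨exists_mvPolynomial_near_sin_l1Norm_logFree ht hω hreg, fun P hP =>
    exists_le_abs_sin_l1Norm_sub_eval (le_trans (by norm_num) ht) hω (card_mul_le_of_regime ht hω hreg) P hP⟩

/-! ## §2 ★★ The law-level (`W₁`) face, log-free and two-sided [folklore] -/

/-- ★★ **LAWS AGREEING ON `Π_t` INTEGRATE `sin(ωΣ|x_i|)` TO WITHIN `160·ωd∕t`.**  Let `P, Q` be probability laws on `ℝ^ι` carried by `[−1,1]^ι`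
with equal mixed moments of total degree `≤ t`, `t ≥ 512`, `ω ≥ 0`, `ωd·(log₂t)² ≤ t∕2048`.  Then
`|∫sin(ωΣ_i|x_i|) dP − ∫sin(ωΣ_i|x_i|) dQ| ≤ 160·ωd∕t` (module 125's transfer with module 140's polynomial; module 125 had
`600log₂t(log₂t + 4ωd)∕t`). [folklore] -/
theorem abs_integral_sin_l1Norm_sub_le_logFree {P Q : Measure (ι → ℝ)} [IsProbabilityMeasure P] [IsProbabilityMeasure Q]
    (hP : P (Set.pi Set.univ (fun _ : ι => Set.Icc (-1 : ℝ) 1))ᶜ = 0) (hQ : Q (Set.pi Set.univ (fun _ : ι => Set.Icc (-1 : ℝ) 1))ᶜ = 0)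
    {t : ℕ} (ht : 512 ≤ t) (hmom : ∀ j : ι → ℕ, ∑ i, j i ≤ t → ∫ x, ∏ i, x i ^ j i ∂P = ∫ x, ∏ i, x i ^ j i ∂Q)
    {ω : ℝ} (hω : 0 ≤ ω) (hreg : ω * Fintype.card ι * Real.logb 2 t ^ 2 ≤ t / 2048) :
    |∫ x, Real.sin (ω * ∑ i, |x i|) ∂P - ∫ x, Real.sin (ω * ∑ i, |x i|) ∂Q| ≤ 160 * (ω * Fintype.card ι) / t := by
  obtain ⟨F, hF, happ⟩ := exists_mvPolynomial_near_sin_l1Norm_logFree (ι := ι) ht hω hreg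
  have hg : Continuous fun x : ι → ℝ => Real.sin (ω * ∑ i, |x i|) :=
    Real.continuous_sin.comp (continuous_const.mul continuous_l1Norm)
  have h := abs_integral_sub_integral_le_of_near hP hQ hmom hg hF happ
  refine h.trans_eq ?_
  ring

/-- ★★ **LAWS AGREEING ON `Π_t` INTEGRATE `cos(ωΣ|x_i|)` TO WITHIN `160·ωd∕t`** (same hypotheses). [folklore] -/
theorem abs_integral_cos_l1Norm_sub_le_logFree {P Q : Measure (ι → ℝ)} [IsProbabilityMeasure P] [IsProbabilityMeasure Q]
    (hP : P (Set.pi Set.univ (fun _ : ι => Set.Icc (-1 : ℝ) 1))ᶜ = 0) (hQ : Q (Set.pi Set.univ (fun _ : ι => Set.Icc (-1 : ℝ) 1))ᶜ = 0)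
    {t : ℕ} (ht : 512 ≤ t) (hmom : ∀ j : ι → ℕ, ∑ i, j i ≤ t → ∫ x, ∏ i, x i ^ j i ∂P = ∫ x, ∏ i, x i ^ j i ∂Q)
    {ω : ℝ} (hω : 0 ≤ ω) (hreg : ω * Fintype.card ι * Real.logb 2 t ^ 2 ≤ t / 2048) :
    |∫ x, Real.cos (ω * ∑ i, |x i|) ∂P - ∫ x, Real.cos (ω * ∑ i, |x i|) ∂Q| ≤ 160 * (ω * Fintype.card ι) / t := by
  obtain ⟨F, hF, happ⟩ := exists_mvPolynomial_near_cos_l1Norm_logFree (ι := ι) ht hω hreg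
  have hg : Continuous fun x : ι → ℝ => Real.cos (ω * ∑ i, |x i|) :=
    Real.continuous_cos.comp (continuous_const.mul continuous_l1Norm)
  have h := abs_integral_sub_integral_le_of_near hP hQ hmom hg hF happ
  refine h.trans_eq ?_
  ring

/-- ★★★ **THE LAW-LEVEL ROW IS `Θ(ωd∕t)` (both sides in one declaration).**  For all `t ≥ 512`, `ω ≥ 0`, finite `ι` (`d = |ι|`) with
`ωd·(log₂t)² ≤ t∕2048`: (UPPER) every two probability laws on `ℝ^ι` carried by `[−1,1]^ι` with equal mixed moments of total degree `≤ t` satisfy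
`|∫sin(ωΣ|x_i|)dP − ∫sin(ωΣ|x_i|)dQ| ≤ 160·ωd∕t`; (LOWER, module 137) there IS such a pair with `∫sin(ωΣ|x_i|)dQ − ∫sin(ωΣ|x_i|)dP ≥ ωd∕(10πt)`.
The `W₁`-form of OPEN-PROBLEM.md for the single-mode test class, two-sided up to the constant `1600π`, no logarithm. [folklore] -/
theorem laws_sinMode_twoSided {t : ℕ} (ht : 512 ≤ t) {ω : ℝ} (hω : 0 ≤ ω)
    (hreg : ω * Fintype.card ι * Real.logb 2 t ^ 2 ≤ t / 2048) :
    (∀ P Q : Measure (ι → ℝ), IsProbabilityMeasure P → IsProbabilityMeasure Q →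
      P (Set.pi Set.univ (fun _ : ι => Set.Icc (-1 : ℝ) 1))ᶜ = 0 → Q (Set.pi Set.univ (fun _ : ι => Set.Icc (-1 : ℝ) 1))ᶜ = 0 →
      (∀ j : ι → ℕ, ∑ i, j i ≤ t → ∫ x, ∏ i, x i ^ j i ∂P = ∫ x, ∏ i, x i ^ j i ∂Q) →
      |∫ x, Real.sin (ω * ∑ i, |x i|) ∂P - ∫ x, Real.sin (ω * ∑ i, |x i|) ∂Q| ≤ 160 * (ω * Fintype.card ι) / t) ∧
    (∃ P Q : Measure (ι → ℝ), IsProbabilityMeasure P ∧ IsProbabilityMeasure Q ∧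
      P (Set.pi Set.univ (fun _ : ι => Set.Icc (-1 : ℝ) 1))ᶜ = 0 ∧ Q (Set.pi Set.univ (fun _ : ι => Set.Icc (-1 : ℝ) 1))ᶜ = 0 ∧
      (∀ j : ι → ℕ, ∑ i, j i ≤ t → ∫ x, ∏ i, x i ^ j i ∂P = ∫ x, ∏ i, x i ^ j i ∂Q) ∧
      ω * Fintype.card ι / (10 * π * t) ≤
        (∫ x, Real.sin (ω * ∑ i, |x i|) ∂Q) - ∫ x, Real.sin (ω * ∑ i, |x i|) ∂P) := by
  refine ⟨fun P Q iP iQ hP hQ hmom => ?_, ?_⟩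
  · exact abs_integral_sin_l1Norm_sub_le_logFree hP hQ ht hmom hω hreg
  · exact exists_laws_equalMixedMoments_sin_l1Norm (le_trans (by norm_num) ht) hω (card_mul_le_of_regime ht hω hreg)

end Summit.QuantumFields.YangMills.Theorems.BalabanUVNodesN19SingleModeTwoSided

end
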